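import Summits.ResolutionOfSingularities.ResolutionOfSingularities.Theorems.DeltaCutGrade
import HarnessLib

/-!
# DeltaCutGrade2 — decomp-res node «GradeCut» (lens-6 g28, critic row 210 CLEARED (F-top eliminated; row-204
re-grant spent)), tree file 2/3 of the node

Content VERBATIM from the decomp-res lens-6 g28 node `HOME/decomp-res-lens-6/g28/GradeCut.lean` (pin 594c5539; no
carry, imports the landed `DeltaCutRefCells` + HarnessLib; namespace `…Theorems.DeltaCutClasses`); HOME =
run/shared/lean/pub/decomp-res; critic CRITIC-LEDGER row 210 CLEARED; landing orders NEXT-g29.md §4 + INBOX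
11:01:55Z — provenance, critic text and the lens header in full in the first file of the node, `DeltaCutGrade`.
`--kind proof --supports stmt-ResolutionOfSingularities-26971`.

## This file

Continuation 2/2 of `DeltaCutGrade` (same namespace / sections of the node, cut at the tree's 400-line cap; section
variables / opens replayed): scopes `GDefs`, `GEngine` — carries `gFrozen_iff_stuck_nonempty`,
`gStuck_iff_surfSing`, `not_gMoves_of_badEmpty`, `not_gMoves_of_surfSing`, `GTerminates.not_gPerpetual`,
`GFrozen.not_gPerpetual`, `GTerminates.not_gFrozen`, `g_trichotomy`, `not_gTerminates_iff`,
`refHop_next_eq_of_not_refMoves`, `gRun_eq_of_not_moves`, `gRun_eq_refRun_of_not_gradeNow`,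
`gRun_eq_refRun_of_refMoves`, `RefTerminates.gTerminates`, `RefPerpetual.gPerpetual`, `refFrozen_top_gMoves`,
`RefFrozen.gFrozen_of_not_surfaceRegular`, `RefFrozen.gMoves_or_gFrozen`, `support_surfaceCentre_subset`,
`gHop_facts`, `wor_of_gTerminatesAt`, `wor_of_gTerminates`, `gRun_facts`.

[WRITER NOTE (decomp-res writer g13): file split only (tree files ≤ 400 lines; the plan's section groups, cut
further by the cap at declaration boundaries); namespace, sections, section `open`s / `variable`s and every
declaration exactly as in the lens (the node's HOME-only dupNamespace-linter line is dropped — the library sets it;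
`noncomputable section`, the two file-level `open` lines, `universe u` and the namespace-level `open
…TwistCutClasses` / `open …LightCutClasses` of the node are replayed in every file).]

(Sources: Hironaka1964; CossartJannsenSaito2020 Ch. 5–8; CossartPiltant2019 Prop. 2.6; Giraud1975; EGAIV2 §5–§6;
StacksProject 0BIQ / 035A / 0804; Matsumura1987 §28–§31; Kollar2007 §3.)
-/

noncomputable section

open CategoryTheory CategoryTheory.Limits AlgebraicGeometry TopologicalSpace IsLocalRing
open Literature.AlgebraicGeometry.Resolution

universe u

namespace Summit.ResolutionOfSingularities.ResolutionOfSingularities.Theorems.DeltaCutClasses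

open Summit.ResolutionOfSingularities.ResolutionOfSingularities.Theorems.TwistCutClasses
open Summit.ResolutionOfSingularities.ResolutionOfSingularities.Theorems.LightCutClasses

section GDefs

open Summit.ResolutionOfSingularities.ResolutionOfSingularities.Theorems
open WeakOrderReduction ForcedTowerClasses SubfieldContactClasses AbsoluteContactClasses PurityValveClasses
open Scheme.IdealSheafData (vanishingIdeal)

/-- **THE FROZEN LETTER IS LITERALLY KIND F-surf-sing** (hypothesis-free): the graded run freezes iff its FIRST MOTIONLESS
level has a NONEMPTY bad locus — and then (by `not_gMoves_iff`) nothing is pending, the reduced closure is irregular, not a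
curve, AND its surface part is IRREGULAR. [new] [folklore] -/
theorem gFrozen_iff_stuck_nonempty {n : ℕ} {R : RefStage} :
    GFrozen n R ↔ ∃ h : ℕ, (∀ j < h, GMoves n (gRun n R j)) ∧ ¬ GMoves n (gRun n R h) ∧ ¬ BadEmpty n (gRun n R h).base := by
  constructor
  · rintro ⟨h, hpre, hP, hne, hirr, hdim, hs⟩
    exact ⟨h, hpre, not_gMoves_iff.mpr ⟨hP, Or.inr ⟨hne, hirr, hdim, hs⟩⟩, hne⟩
  · rintro ⟨h, hpre, hstop, hne⟩
    obtain ⟨hP, he | ⟨_, hirr, hdim, hs⟩⟩ := not_gMoves_iff.mp hstop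
    · exact absurd he hne
    · exact ⟨h, hpre, hP, hne, hirr, hdim, hs⟩

/-- **SINGLE-LEVEL FORM OF THE SUB-KIND THEOREM** (`gFrozen_iff_surfSing` of the pricing, hypothesis-free): a level is STUCK
with a NONEMPTY bad locus iff it is LITERALLY of kind F-surf-sing — nothing pending, bad locus nonempty, reduced
closure irregular,
not a curve, surface part irregular.  In particular NO F-top level, no active level, no curve-frozen level and no
pending phase is
ever stuck. [new] [folklore] -/
theorem gStuck_iff_surfSing {n : ℕ} {R : RefStage} :
    (¬ GMoves n R ∧ ¬ BadEmpty n R.base) ↔ (R.pending = none ∧ ¬ BadEmpty n R.base ∧ ¬ ClosureRegular n R.base ∧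
      ¬ DimLEOne (badClosure n R.base) ∧ ¬ SurfaceRegular n R.base) := by
  constructor
  · rintro ⟨hstop, hne⟩
    obtain ⟨hP, he | ⟨_, hirr, hdim, hs⟩⟩ := not_gMoves_iff.mp hstop
    · exact absurd he hne
    · exact ⟨hP, hne, hirr, hdim, hs⟩
  · rintro ⟨hP, hne, hirr, hdim, hs⟩
    exact ⟨not_gMoves_iff.mpr ⟨hP, Or.inr ⟨hne, hirr, hdim, hs⟩⟩, hne⟩

/-- a level with nothing pending and empty bad locus does not move. [new] [folklore] -/
theorem not_gMoves_of_badEmpty {n : ℕ} {R : RefStage} (hP : R.pending = none) (he : BadEmpty n R.base) : ¬ GMoves n R :=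
  not_gMoves_iff.mpr ⟨hP, Or.inl he⟩

/-- a level with nothing pending, nonempty bad locus, irregular non-curve closure and IRREGULAR surface part does not move.
[new] [folklore] -/
theorem not_gMoves_of_surfSing {n : ℕ} {R : RefStage} (hP : R.pending = none) (hne : ¬ BadEmpty n R.base)
    (hirr : ¬ ClosureRegular n R.base) (hdim : ¬ DimLEOne (badClosure n R.base)) (hs : ¬ SurfaceRegular n R.base) :
    ¬ GMoves n R :=
  not_gMoves_iff.mpr ⟨hP, Or.inr ⟨hne, hirr, hdim, hs⟩⟩

/-- exclusivity: a terminating graded run is not perpetual. [new] [folklore] -/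
theorem GTerminates.not_gPerpetual {n : ℕ} {R : RefStage} (h : GTerminates n R) : ¬ GPerpetual n R :=
  fun hP => by obtain ⟨i, _, hP0, he⟩ := h; exact not_gMoves_of_badEmpty hP0 he (hP i)

/-- exclusivity: a frozen graded run is not perpetual. [new] [folklore] -/
theorem GFrozen.not_gPerpetual {n : ℕ} {R : RefStage} (h : GFrozen n R) : ¬ GPerpetual n R :=
  fun hP => by obtain ⟨i, _, hP0, hne, hirr, hdim, hs⟩ := h; exact not_gMoves_of_surfSing hP0 hne hirr hdim hs (hP i)

/-- exclusivity: a terminating graded run is not frozen (the first non-moving level is unique). [new] [folklore] -/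
theorem GTerminates.not_gFrozen {n : ℕ} {R : RefStage} (h : GTerminates n R) : ¬ GFrozen n R := by
  rintro ⟨i', hpre', hP', hne', hirr', hdim', hs'⟩
  obtain ⟨i, hpre, hP0, he⟩ := h
  rcases lt_trichotomy i i' with hlt | rfl | hgt
  · exact not_gMoves_of_badEmpty hP0 he (hpre' i hlt)
  · exact hne' he
  · exact not_gMoves_of_surfSing hP' hne' hirr' hdim' hs' (hpre i' hgt)

/-- **TRICHOTOMY OF THE GRADED RUN** (hypothesis-free): it terminates, or freezes (at a non-curve closure with irregular surface
part), or is perpetual. [new] [folklore] -/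
theorem g_trichotomy (n : ℕ) (R : RefStage) : GTerminates n R ∨ GFrozen n R ∨ GPerpetual n R := by
  classical
  by_cases hP : GPerpetual n R
  · exact Or.inr (Or.inr hP)
  · have hex : ∃ i : ℕ, ¬ GMoves n (gRun n R i) := not_forall.mp hP
    have hh : ¬ GMoves n (gRun n R (Nat.find hex)) := Nat.find_spec hex
    have hpre : ∀ j < Nat.find hex, GMoves n (gRun n R j) := fun j hj => not_not.mp (Nat.find_min hex hj)
    obtain ⟨hP0, he | ⟨hne, hirr, hdim, hs⟩⟩ := not_gMoves_iff.mp hh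
    · exact Or.inl ⟨Nat.find hex, hpre, hP0, he⟩
    · exact Or.inr (Or.inl ⟨Nat.find hex, hpre, hP0, hne, hirr, hdim, hs⟩)

/-- **THE RESIDUAL LETTER READ EXACTLY**: `¬ GTerminates ⟺ GFrozen ∨ GPerpetual` (hypothesis-free). [new] [folklore] -/
theorem not_gTerminates_iff (n : ℕ) (R : RefStage) : ¬ GTerminates n R ↔ GFrozen n R ∨ GPerpetual n R := by
  constructor
  · intro h
    rcases g_trichotomy n R with ht | hf | hp
    · exact absurd ht h
    · exact Or.inl hf
    · exact Or.inr hp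
  · rintro (hf | hp) ht
    · exact ht.not_gFrozen hf
    · exact ht.not_gPerpetual hp

/-- a non-moving refined stage is fixed by g27's hop. [folklore] -/
theorem refHop_next_eq_of_not_refMoves {n : ℕ} {Q : RefStage} (hQ : ¬ RefMoves n Q) : (refHop n Q).next = Q := by
  obtain ⟨hP, _⟩ := not_refMoves_iff.mp hQ
  have hc : ¬ CurveFrozen n Q.base := fun hc => hQ (refMoves_of_curveFrozen hc)
  have ha : ¬ SepActive n Q.base := fun ha => hQ (refMoves_of_sepActive ha)
  rw [RefStage.eq_ofStage hP, refHop_eq_sep hc]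
  show (⟨(sepHop n Q.base).next, none⟩ : RefStage) = ⟨Q.base, none⟩
  rw [sepHop_next_of_not_active ha]

/-- **A NON-MOVING LEVEL IS FINAL**: from the first non-moving level on, the graded run STAYS. [new] [folklore] -/
theorem gRun_eq_of_not_moves {n : ℕ} {R : RefStage} {h : ℕ} (hh : ¬ GMoves n (gRun n R h)) :
    ∀ i : ℕ, h ≤ i → gRun n R i = gRun n R h := by
  have hstep : ∀ Q : RefStage, ¬ GMoves n Q → (gHop n Q).next = Q := by
    intro Q hQ
    rw [gHop_eq_refHop fun hg => hQ (Or.inr hg)]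
    exact refHop_next_eq_of_not_refMoves fun hm => hQ (Or.inl hm)
  intro i hi
  obtain ⟨d, rfl⟩ := Nat.exists_eq_add_of_le hi
  induction d with
  | zero => rfl
  | succ d ih => rw [← Nat.add_assoc, gRun_succ, ih (Nat.le_add_right h d), hstep _ hh]

/-! #### The graded run EXTENDS the refined run: below the first firing stage the two coincide -/

/-- on a prefix WITHOUT firing stages the graded run IS g27's refined run. [new] [folklore] -/
theorem gRun_eq_refRun_of_not_gradeNow {n : ℕ} (R : RefStage) {h : ℕ} (hpre : ∀ j < h, ¬ GradeNow n (refRun n R j)) :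
    ∀ i ≤ h, gRun n R i = refRun n R i := by
  intro i
  induction i with
  | zero => intro _; rfl
  | succ i ih =>
    intro hi
    rw [gRun_succ, ih (Nat.le_of_succ_le hi), gHop_eq_refHop (hpre i (Nat.lt_of_succ_le hi)), refRun_succ]

/-- on a prefix along which g27's refined run MOVES the graded run IS the refined run. [new] [folklore] -/
theorem gRun_eq_refRun_of_refMoves {n : ℕ} (R : RefStage) {h : ℕ} (hpre : ∀ j < h, RefMoves n (refRun n R j)) :
    ∀ i ≤ h, gRun n R i = refRun n R i :=
  gRun_eq_refRun_of_not_gradeNow R fun j hj => not_gradeNow_of_refMoves (hpre j hj)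

/-- **g27's DECIDED CELL SITS INSIDE THE GRADED DECIDED CELL**: a terminating refined run is a terminating graded run (same
height). [new] [folklore] -/
theorem RefTerminates.gTerminates {n : ℕ} {R : RefStage} (h : RefTerminates n R) : GTerminates n R := by
  obtain ⟨h, hpre, hP, he⟩ := h
  refine ⟨h, fun j hj => ?_, ?_, ?_⟩
  · rw [gRun_eq_refRun_of_refMoves R hpre j hj.le]; exact Or.inl (hpre j hj)
  · rw [gRun_eq_refRun_of_refMoves R hpre h le_rfl]; exact hP
  · rw [gRun_eq_refRun_of_refMoves R hpre h le_rfl]; exact he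

/-- a perpetual refined run is a perpetual graded run (kind P′ ⊆ kind P″). [new] [folklore] -/
theorem RefPerpetual.gPerpetual {n : ℕ} {R : RefStage} (h : RefPerpetual n R) : GPerpetual n R := fun i => by
  rw [gRun_eq_refRun_of_refMoves R (h := i) (fun j _ => h j) i le_rfl]; exact Or.inl (h i)

/-- **THE SUB-KIND THEOREM · THE SUB-KIND F-top IS GONE**: a refined run FROZEN at level `h` (moving prefix, nothing pending)
whose frozen level is `TopFrozen` — bad `≠ ∅`, closure irregular, not a curve, SURFACE PART REGULAR: G₀ — is a graded run that
MOVES at level `h`, and the move IS the blow-up of the reduced surface part. [new] [folklore] -/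
theorem refFrozen_top_gMoves {n : ℕ} {R : RefStage} {h : ℕ} (hpre : ∀ j < h, RefMoves n (refRun n R j))
    (hP : (refRun n R h).pending = none) (hT : TopFrozen n (refRun n R h).base) :
    GMoves n (gRun n R h) ∧
      gRun n R (h + 1) = ((refRun n R h).exit n (surfacePart (badClosure n (refRun n R h).base))).next := by
  have e : gRun n R h = refRun n R h := gRun_eq_refRun_of_refMoves R hpre h le_rfl
  refine ⟨by rw [e]; exact Or.inr ⟨hP, hT⟩, ?_⟩
  rw [gRun_succ, e, gHop_eq_grade ⟨hP, hT⟩]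

/-- a refined run frozen at a level with IRREGULAR surface part is a frozen graded run (kind F-surf-sing is what remains of kind
F-surface; H). [new] [folklore] -/
theorem RefFrozen.gFrozen_of_not_surfaceRegular {n : ℕ} {R : RefStage} {h : ℕ} (hpre : ∀ j < h, RefMoves n (refRun n R j))
    (hP : (refRun n R h).pending = none) (hne : ¬ BadEmpty n (refRun n R h).base) (hirr : ¬ ClosureRegular n (refRun n R h).base)
    (hdim : ¬ DimLEOne (badClosure n (refRun n R h).base)) (hs : ¬ SurfaceRegular n (refRun n R h).base) : GFrozen n R := by
  refine ⟨h, fun j hj => ?_, ?_⟩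
  · rw [gRun_eq_refRun_of_refMoves R hpre j hj.le]; exact Or.inl (hpre j hj)
  · rw [gRun_eq_refRun_of_refMoves R hpre h le_rfl]; exact ⟨hP, hne, hirr, hdim, hs⟩

/-- the two refined residual kinds and the graded letters: a refined-FROZEN run is graded-MOVING at its frozen level (F-top) or
graded-FROZEN there (F-surf-sing) — excluded middle on the surface test. [new] [folklore] -/
theorem RefFrozen.gMoves_or_gFrozen {n : ℕ} {R : RefStage} (h : RefFrozen n R) :
    (∃ h : ℕ, (∀ j < h, RefMoves n (refRun n R j)) ∧ TopFrozen n (refRun n R h).base ∧ GMoves n (gRun n R h)) ∨ GFrozen n R := by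
  obtain ⟨h, hpre, hP, hne, hirr, hdim⟩ := h
  by_cases hs : SurfaceRegular n (refRun n R h).base
  · exact Or.inl ⟨h, hpre, ⟨hne, hirr, hdim, hs⟩, (refFrozen_top_gMoves hpre hP ⟨hne, hirr, hdim, hs⟩).1⟩
  · exact Or.inr (RefFrozen.gFrozen_of_not_surfaceRegular hpre hP hne hirr hdim hs)

end GDefs

section GEngine

open Summit.ResolutionOfSingularities.ResolutionOfSingularities.Theorems
open WeakOrderReduction ForcedTowerClasses SubfieldContactClasses AbsoluteContactClasses PurityValveClasses
open Scheme.IdealSheafData (vanishingIdeal)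

/-! ### §GEngine — PERMISSIBILITY OF EVERY GRADED HOP PROVED; ONE ENGINE FOR ALL HEIGHTS -/

/-- **THE GRADED CENTRE LIES INSIDE THE TOP LOCUS**: `𝓘(surface part)` is supported on the surface part `⊆` closure
bad `⊆ Supp(𝓘,n)`
(g26's limit-point lemma `closure_badLocus_subset_support`). [new] [folklore] -/
theorem support_surfaceCentre_subset {k : Type} [Field k] {Y : Scheme.{0}} {g : Y ⟶ Spec (.of k)} (hB : IsBase Y g) {n : ℕ}
    {M : MarkedIdeal Y} (hM : IsDatum n M) :
    ((vanishingIdeal (surfacePart (badClosure n ⟨Y, M.ideal⟩))).support : Set Y) ⊆ M.support := by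
  rw [Scheme.IdealSheafData.coe_support_vanishingIdeal]
  exact (surfacePart_subset _).trans (closure_badLocus_subset_support hB hM)

/-- **ONE GRADED HOP OF A BASE DATUM** (nothing pending, or a pending curve inside its support): the next graded
stage is again a
base `n`-datum (nothing pending, or a pending curve inside its support), EVERY CENTRE BLOWN UP IS REGULAR AND INSIDE THE TOP
LOCUS — at a firing stage the reduced surface part (regular by the test `TopFrozen`, inside the support by
`support_surfaceCentre_subset`), elsewhere g27's `refHop_facts` verbatim — and a weak resolution of the next datum
splices to one of
the present datum. [new] [folklore] -/
theorem gHop_facts {k : Type} [Field k] {Y : Scheme.{0}} {g : Y ⟶ Spec (.of k)} (hB : IsBase Y g) {n : ℕ}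
    {M : MarkedIdeal Y} (hM : IsDatum n M) (P : Option (Closeds Y))
    (hP : ∀ S, P = some S → DimLEOne S ∧ (S : Set Y) ⊆ M.support) :
    ∃ (Y₁ : Scheme.{0}) (g₁ : Y₁ ⟶ Spec (.of k)) (M₁ : MarkedIdeal Y₁) (P₁ : Option (Closeds Y₁)),
      IsBase Y₁ g₁ ∧ IsDatum n M₁ ∧ (gHop n ⟨⟨Y, M.ideal⟩, P⟩).next = ⟨⟨Y₁, M₁.ideal⟩, P₁⟩ ∧
      (∀ S₁, P₁ = some S₁ → DimLEOne S₁ ∧ (S₁ : Set Y₁) ⊆ M₁.support) ∧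
      ((∃ t', WeakResolution t' M₁) → ∃ t : CentreSeq Y, WeakResolution t M) := by
  by_cases hg : GradeNow n ⟨⟨Y, M.ideal⟩, P⟩
  · -- GRADE: blow up the reduced (regular) surface part of the bad closure, nothing pending afterwards
    obtain ⟨hPn, hT⟩ := hg
    have hPn' : P = none := hPn
    subst hPn'
    obtain ⟨hB₁, hM₁, hI₁, hsp⟩ := blowup_facts hB hM (vanishingIdeal (surfacePart (badClosure n ⟨Y, M.ideal⟩))) hT.2.2.2
      (support_surfaceCentre_subset hB hM)
    refine ⟨blowup (vanishingIdeal (surfacePart (badClosure n ⟨Y, M.ideal⟩))),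
      blowup.π (vanishingIdeal (surfacePart (badClosure n ⟨Y, M.ideal⟩))) ≫ g,
      M.transform (blowup.π (vanishingIdeal (surfacePart (badClosure n ⟨Y, M.ideal⟩))))
        (vanishingIdeal (surfacePart (badClosure n ⟨Y, M.ideal⟩))),
      none, hB₁, hM₁, ?_, fun S₁ h => (Option.some_ne_none S₁ h.symm).elim, hsp⟩
    rw [gHop_eq_grade ⟨hPn, hT⟩]
    show (⟨⟨blowup (vanishingIdeal (surfacePart (badClosure n ⟨Y, M.ideal⟩))),
      controlledTransform (blowup.π (vanishingIdeal (surfacePart (badClosure n ⟨Y, M.ideal⟩))))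
        (vanishingIdeal (surfacePart (badClosure n ⟨Y, M.ideal⟩))) M.ideal n⟩, none⟩ : RefStage) = _
    rw [← hI₁]
  · rw [gHop_eq_refHop hg]
    exact refHop_facts hB hM P hP

/-- **THE GRADED ENGINE, ITERATED (one theorem for ALL heights).**  For every `h`: a base `n`-datum, with nothing pending or a
pending curve inside its support, whose graded run MOVES below level `h` and has NOTHING PENDING and EMPTY bad locus
at level `h`
has a weak resolution, given `SeqDimFour 5 n` — induction on `h` (`h = 0`: g27's engine at height `0` = g23's
closing law; `h + 1`:
`gHop_facts` + the tail identity `gRun_succ_front` + the splice). [new] [folklore] -/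
theorem wor_of_gTerminatesAt {n : ℕ} (hn : 1 ≤ n) (h5 : SeqDimFour 5 n) (p : ℕ) (hp : p.Prime) (k : Type) [Field k]
    [CharP k p] : ∀ (h : ℕ) (Y : Scheme.{0}) (g : Y ⟶ Spec (.of k)), IsBase Y g → ∀ M : MarkedIdeal Y, IsDatum n M →
      ∀ P : Option (Closeds Y), (∀ S, P = some S → DimLEOne S ∧ (S : Set Y) ⊆ M.support) →
      (∀ j < h, GMoves n (gRun n ⟨⟨Y, M.ideal⟩, P⟩ j)) → (gRun n ⟨⟨Y, M.ideal⟩, P⟩ h).pending = none →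
      BadEmpty n (gRun n ⟨⟨Y, M.ideal⟩, P⟩ h).base → ∃ t : CentreSeq Y, WeakResolution t M := by
  intro h
  induction h with
  | zero =>
    intro Y g hB M hM P hP _ hpend hemp
    exact wor_of_refTerminatesAt hn h5 p hp k 0 Y g hB M hM P hP (fun j hj => (Nat.not_lt_zero j hj).elim) hpend hemp
  | succ h ih =>
    intro Y g hB M hM P hP hpre hpend hemp
    obtain ⟨Y₁, g₁, M₁, P₁, hB₁, hM₁, hS, hP₁, hsp⟩ := gHop_facts hB hM P hP
    have e : ∀ j, gRun n ⟨⟨Y, M.ideal⟩, P⟩ (j + 1) = gRun n ⟨⟨Y₁, M₁.ideal⟩, P₁⟩ j := fun j => by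
      rw [gRun_succ_front, hS]
    refine hsp (ih Y₁ g₁ hB₁ M₁ hM₁ P₁ hP₁ (fun j hj => ?_) ?_ ?_)
    · have := hpre (j + 1) (Nat.succ_lt_succ hj); rwa [e] at this
    · have := hpend; rwa [e] at this
    · have := hemp; rwa [e] at this

/-- **THE GRADED ENGINE · the decided cell closes**: a base `n`-datum whose graded run TERMINATES has a weak resolution, given
`SeqDimFour 5 n`. [new] [folklore] -/
theorem wor_of_gTerminates {n : ℕ} (hn : 1 ≤ n) (h5 : SeqDimFour 5 n) (p : ℕ) (hp : p.Prime) (k : Type) [Field k]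
    [CharP k p] (Y : Scheme.{0}) (g : Y ⟶ Spec (.of k)) (hB : IsBase Y g) (M : MarkedIdeal Y) (hM : IsDatum n M)
    (hG : GTerminates n ⟨⟨Y, M.ideal⟩, none⟩) : ∃ t : CentreSeq Y, WeakResolution t M := by
  obtain ⟨h, hpre, hpend, hemp⟩ := hG
  exact wor_of_gTerminatesAt hn h5 p hp k h Y g hB M hM none (fun S h => (Option.some_ne_none S h.symm).elim) hpre hpend hemp

/-- **EVERY LEVEL OF THE GRADED RUN OF A BASE DATUM IS A BASE DATUM** (with nothing pending or a pending curve inside its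
support). [new] [folklore] -/
theorem gRun_facts {k : Type} [Field k] {Y : Scheme.{0}} {g : Y ⟶ Spec (.of k)} (hB : IsBase Y g) {n : ℕ}
    {M : MarkedIdeal Y} (hM : IsDatum n M) (P : Option (Closeds Y))
    (hP : ∀ S, P = some S → DimLEOne S ∧ (S : Set Y) ⊆ M.support) : ∀ i : ℕ,
    ∃ (Yᵢ : Scheme.{0}) (gᵢ : Yᵢ ⟶ Spec (.of k)) (Mᵢ : MarkedIdeal Yᵢ) (Pᵢ : Option (Closeds Yᵢ)),
      IsBase Yᵢ gᵢ ∧ IsDatum n Mᵢ ∧ gRun n ⟨⟨Y, M.ideal⟩, P⟩ i = ⟨⟨Yᵢ, Mᵢ.ideal⟩, Pᵢ⟩ ∧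
      (∀ Sᵢ, Pᵢ = some Sᵢ → DimLEOne Sᵢ ∧ (Sᵢ : Set Yᵢ) ⊆ Mᵢ.support)
  | 0 => ⟨Y, g, M, P, hB, hM, rfl, hP⟩
  | i + 1 => by
    obtain ⟨Yᵢ, gᵢ, Mᵢ, Pᵢ, hBᵢ, hMᵢ, e, hPᵢ⟩ := gRun_facts hB hM P hP i
    obtain ⟨Y₁, g₁, M₁, P₁, hB₁, hM₁, hS, hP₁, -⟩ := gHop_facts hBᵢ hMᵢ Pᵢ hPᵢ
    exact ⟨Y₁, g₁, M₁, P₁, hB₁, hM₁, by rw [gRun_succ, e, hS], hP₁⟩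

end GEngine

end Summit.ResolutionOfSingularities.ResolutionOfSingularities.Theorems.DeltaCutClasses
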